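import Summits.ValiantsHypothesis.ValiantsHypothesis.Theorems.SymPencilPerFourPeeledTwoPencilChordW0

/-!
# Route `SymPencil` — inner rank of the `2 | 2` row split of `per_4`, PEELED case: `Q ≠ 0` for the
# numeric `W₀` pencil and the complete chart (`--supports` stmt-ValiantsHypothesis-5674
# `SdcSuperquadratic`; (8,8) column, memo `NOTE-p8g15-5674-R2-two-pencil.md` §9.6; rung currency only)

`…TwoPencilChordW0.frames_of_W0` kept `Q ≠ 0` as a hypothesis.  Row `3` of
`det 𝐇(z₀)·a₀₃a₀ₗ·Q₃ₗ` is `56·Σ_k c̃_{lk} ξ̂_k` with the Klein pattern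
`c̃ = [[0,−A,B,−C],[−A,0,−C,B],[B,−C,0,−A],[−C,B,−A,0]]`, `(A,B,C) = (−8, 7, 15)`, `B = A + C`
(exact, `compute/diag`), kernel `K·𝟙`; hence (`w0_Q_ne_zero`) `Q ≠ 0` for `a₁ ∉ K a₀`, and
(★ `frames_of_W0_of_indep`) the chart needs only the incidences and `a₁ ∉ K a₀`.

Honest framing: atlas chart; no cell closes here; the window `28 ≤ sdc(per₄) ≤ 29` of record, the
crux `SdcSuperquadratic` and `VP ≠ VNP` are untouched.  No definitions, no named facts. [folklore]
-/

noncomputable section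

-- single-conjunct layout: Sub = Summit, duplicated namespace component intended
set_option linter.dupNamespace false

namespace Summit.ValiantsHypothesis.ValiantsHypothesis.Theorems.SymPencilPerFourPeeledTwoPencilChordW0Q

open Matrix Finset Module
open Summit.ValiantsHypothesis.ValiantsHypothesis.Theorems.SymPencilPerFourPeeledTwoPencilSigmaZero
open Summit.ValiantsHypothesis.ValiantsHypothesis.Theorems.SymPencilPerFourPeeledTwoPencilTransport
open Summit.ValiantsHypothesis.ValiantsHypothesis.Theorems.SymPencilPerFourPeeledTwoPencilCaseAQ
open Summit.ValiantsHypothesis.ValiantsHypothesis.Theorems.SymPencilPerFourPeeledTwoPencilChordW0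

universe u

variable {K : Type u} [Field K]

/-- **`Q ≠ 0` for the `W₀` frames**, given `a₀` with non-zero coordinates and `a₁ ∉ K a₀`.
[folklore] -/
theorem w0_Q_ne_zero [CharZero K] (a₀ a₁ : Fin 4 → K) (ha : ∀ k, a₀ k ≠ 0)
    (hind : ∀ μ : K, a₁ ≠ μ • a₀) :
    (Matrix.of fun b l : Fin 4 =>
          (Matrix.of ![a₁, Pi.single b (1 : K), (fun k => a₀ k * (![-2, -3, 5, 0] : Fin 4 → K) k), Pi.single l 1]).permanent) -
        (Matrix.of fun b l : Fin 4 =>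
          (Matrix.of ![a₀, Pi.single b (1 : K), (fun k => a₀ k * (![-2, -3, 5, 0] : Fin 4 → K) k), Pi.single l 1]).permanent) *
        ((a₀ 0 * a₀ 1 * a₀ 2 * a₀ 3)⁻¹ •
          (Matrix.diagonal a₀ * ((!![0, 2, -3, 3; 2, 0, -5, 1; -3, -5, 0, -4; 3, 1, -4, 0] : Matrix (Fin 4) (Fin 4) K))⁻¹ * Matrix.diagonal a₀)) *
        (Matrix.of fun b l : Fin 4 =>
          (Matrix.of ![a₁, Pi.single b (1 : K), (fun k => a₀ k * (![-3, -1, 4, -2] : Fin 4 → K) k), Pi.single l 1]).permanent)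
        ≠ 0 := by
  intro hQ0
  let z₀ : Fin 4 → K := ![-3, -1, 4, -2]
  let z₁ : Fin 4 → K := ![-2, -3, 5, 0]
  let P₁₁ : Matrix (Fin 4) (Fin 4) K := Matrix.of fun b l : Fin 4 =>
    (Matrix.of ![a₁, Pi.single b (1 : K), (fun k => a₀ k * z₁ k), Pi.single l 1]).permanent
  let P₁₀ : Matrix (Fin 4) (Fin 4) K := Matrix.of fun b l : Fin 4 =>
    (Matrix.of ![a₀, Pi.single b (1 : K), (fun k => a₀ k * z₁ k), Pi.single l 1]).permanent
  let P₀₁ : Matrix (Fin 4) (Fin 4) K := Matrix.of fun b l : Fin 4 =>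
    (Matrix.of ![a₁, Pi.single b (1 : K), (fun k => a₀ k * z₀ k), Pi.single l 1]).permanent
  set pa : K := a₀ 0 * a₀ 1 * a₀ 2 * a₀ 3 with hpa
  have hpa0 : pa ≠ 0 := by
    rw [hpa]; exact mul_ne_zero (mul_ne_zero (mul_ne_zero (ha 0) (ha 1)) (ha 2)) (ha 3)
  let D : Matrix (Fin 4) (Fin 4) K := Matrix.diagonal a₀
  let Di : Matrix (Fin 4) (Fin 4) K := Matrix.diagonal fun k => (a₀ k)⁻¹
  have hDiD : Di * D = 1 := by
    rw [Matrix.diagonal_mul_diagonal, ← Matrix.diagonal_one]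
    congr 1; funext k; exact inv_mul_cancel₀ (ha k)
  have hc2 : ∀ X : Matrix (Fin 4) (Fin 4) K, Di * (D * X) = X := fun X => by
    rw [← Matrix.mul_assoc, hDiD, Matrix.one_mul]
  set dt : K := -80 with hdt
  have hdt0 : dt ≠ 0 := by rw [hdt]; norm_num
  let H₀ : Matrix (Fin 4) (Fin 4) K := !![0, 2, -3, 3; 2, 0, -5, 1; -3, -5, 0, -4; 3, 1, -4, 0]
  let ADJ : Matrix (Fin 4) (Fin 4) K := !![40, -40, 20, 20; -40, 72, -12, -60; 20, -12, 12, 20; 20, -60, 20, 60]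
  have hadj : ADJ * H₀ = dt • (1 : Matrix (Fin 4) (Fin 4) K) := w0_adj
  have hinv : H₀⁻¹ = dt⁻¹ • ADJ := by
    refine Matrix.inv_eq_left_inv ?_
    rw [Matrix.smul_mul, hadj, smul_smul, inv_mul_cancel₀ hdt0, one_smul]
  let H₁ : Matrix (Fin 4) (Fin 4) K := Matrix.of fun b l : Fin 4 =>
    if b = l then (0 : K) else (z₁ 0 + z₁ 1 + z₁ 2 + z₁ 3) - z₁ b - z₁ l
  have T1 : P₁₀ = pa • (Di * H₁ * Di) := transport_hess a₀ z₁ ha H₁ (fun b l => rfl)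
  have hPW : P₁₀ * ((a₀ 0 * a₀ 1 * a₀ 2 * a₀ 3)⁻¹ • (Matrix.diagonal a₀ * H₀⁻¹ * Matrix.diagonal a₀)) =
      dt⁻¹ • (Di * (H₁ * (ADJ * D))) := by
    rw [T1, hinv, ← hpa]
    show (pa • (Di * H₁ * Di)) * (pa⁻¹ • (D * (dt⁻¹ • ADJ) * D)) = dt⁻¹ • (Di * (H₁ * (ADJ * D)))
    simp only [Matrix.smul_mul, Matrix.mul_smul, smul_smul, Matrix.mul_assoc, hc2]
    have hsc : pa⁻¹ * dt⁻¹ * pa = dt⁻¹ := by field_simp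
    rw [hsc]
  have hrow : ∀ m : Fin 4, (Di * (H₁ * (ADJ * D))) 3 m =
      (a₀ 3)⁻¹ * (((2 : K) * ADJ 0 m + (3 : K) * ADJ 1 m + (-5 : K) * ADJ 2 m) * a₀ m) := by
    intro m
    rw [Matrix.diagonal_mul, Matrix.mul_apply]
    simp only [D, Fin.sum_univ_four, Matrix.mul_diagonal]
    have r0 : H₁ 3 0 = 2 := by simp [H₁, z₁]; norm_num
    have r1 : H₁ 3 1 = 3 := by simp [H₁, z₁]; norm_num
    have r2 : H₁ 3 2 = -5 := by simp [H₁, z₁]; norm_num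
    have r3 : H₁ 3 3 = 0 := by simp [H₁]
    rw [r0, r1, r2, r3]; ring
  have hP01 : P₀₁ = !![0, (-2) * a₀ 3 * a₁ 2 + (4) * a₀ 2 * a₁ 3, (-2) * a₀ 3 * a₁ 1 + (-1) * a₀ 1 * a₁ 3, (4) * a₀ 2 * a₁ 1 + (-1) * a₀ 1 * a₁ 2;
      (-2) * a₀ 3 * a₁ 2 + (4) * a₀ 2 * a₁ 3, 0, (-2) * a₀ 3 * a₁ 0 + (-3) * a₀ 0 * a₁ 3, (4) * a₀ 2 * a₁ 0 + (-3) * a₀ 0 * a₁ 2;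
      (-2) * a₀ 3 * a₁ 1 + (-1) * a₀ 1 * a₁ 3, (-2) * a₀ 3 * a₁ 0 + (-3) * a₀ 0 * a₁ 3, 0, (-1) * a₀ 1 * a₁ 0 + (-3) * a₀ 0 * a₁ 1;
      (4) * a₀ 2 * a₁ 1 + (-1) * a₀ 1 * a₁ 2, (4) * a₀ 2 * a₁ 0 + (-3) * a₀ 0 * a₁ 2, (-1) * a₀ 1 * a₁ 0 + (-3) * a₀ 0 * a₁ 1, 0] := by
    ext m l
    simp only [P₀₁, z₀, Matrix.of_apply]
    rw [per_single_mixed]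
    fin_cases m <;> fin_cases l <;> simp [Fin.sum_univ_four] <;> ring
  have hP11 : ∀ l : Fin 4, P₁₁ 3 l = (![(5) * a₀ 2 * a₁ 1 + (-3) * a₀ 1 * a₁ 2, (5) * a₀ 2 * a₁ 0 + (-2) * a₀ 0 * a₁ 2, (-3) * a₀ 1 * a₁ 0 + (-2) * a₀ 0 * a₁ 1, 0] : Fin 4 → K) l := by
    intro l
    simp only [P₁₁, z₁, Matrix.of_apply]
    rw [per_single_mixed]
    fin_cases l <;> simp [Fin.sum_univ_four] <;> ring
  have E : ∀ l : Fin 4, P₁₁ 3 l - ∑ m : Fin 4, (dt⁻¹ • (Di * (H₁ * (ADJ * D)))) 3 m * P₀₁ m l = 0 := by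
    intro l
    have := congr_fun (congr_fun hQ0 3) l
    rw [Matrix.zero_apply, Matrix.sub_apply, Matrix.mul_apply, hPW] at this
    exact this
  have ha0 := ha 0; have ha1 := ha 1; have ha2 := ha 2; have ha3 := ha 3
  have step : ∀ l : Fin 4,
      (P₁₁ 3 l - ∑ m : Fin 4, (dt⁻¹ • (Di * (H₁ * (ADJ * D)))) 3 m * P₀₁ m l) * (dt * a₀ 3 * a₀ l) =
      P₁₁ 3 l * dt * a₀ 3 * a₀ l -
        ∑ m : Fin 4, ((2 : K) * ADJ 0 m + (3 : K) * ADJ 1 m + (-5 : K) * ADJ 2 m) * a₀ m * a₀ l * P₀₁ m l := by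
    intro l
    simp only [Matrix.smul_apply, smul_eq_mul, hrow, Finset.sum_mul, sub_mul]
    congr 1
    · ring
    · refine Finset.sum_congr rfl fun m _ => ?_
      field_simp
  have hA00 : ADJ 0 0 = 40 := rfl
  have hA01 : ADJ 0 1 = -40 := rfl
  have hA02 : ADJ 0 2 = 20 := rfl
  have hA03 : ADJ 0 3 = 20 := rfl
  have hA10 : ADJ 1 0 = -40 := rfl
  have hA11 : ADJ 1 1 = 72 := rfl
  have hA12 : ADJ 1 2 = -12 := rfl
  have hA13 : ADJ 1 3 = -60 := rfl
  have hA20 : ADJ 2 0 = 20 := rfl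
  have hA21 : ADJ 2 1 = -12 := rfl
  have hA22 : ADJ 2 2 = 12 := rfl
  have hA23 : ADJ 2 3 = 20 := rfl
  have Z : ∀ l : Fin 4, P₁₁ 3 l * dt * a₀ 3 * a₀ l -
      ∑ m : Fin 4, ((2 : K) * ADJ 0 m + (3 : K) * ADJ 1 m + (-5 : K) * ADJ 2 m) * a₀ m * a₀ l * P₀₁ m l = 0 := by
    intro l; rw [← step l, E l, zero_mul]
  have Z1 := Z 1; have Z2 := Z 2; have Z3 := Z 3
  simp only [Fin.sum_univ_four, hP11, hA00, hA01, hA02, hA03, hA10, hA11, hA12, hA13, hA20, hA21, hA22, hA23, hdt] at Z1 Z2 Z3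
  rw [hP01] at Z1 Z2 Z3
  simp only [Matrix.of_apply, Matrix.cons_val', Matrix.cons_val_zero, Matrix.cons_val_one,
    Matrix.cons_val_two, Matrix.cons_val_three,
    Matrix.empty_val', Matrix.cons_val_fin_one, Matrix.vecHead, Matrix.vecTail,
    Function.comp_apply, Fin.succ_zero_eq_one, Fin.succ_one_eq_two] at Z1 Z2 Z3
  set x0 : K := a₁ 0 * (a₀ 1 * a₀ 2 * a₀ 3) with hx0
  set x1 : K := a₁ 1 * (a₀ 0 * a₀ 2 * a₀ 3) with hx1
  set x2 : K := a₁ 2 * (a₀ 0 * a₀ 1 * a₀ 3) with hx2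
  set x3 : K := a₁ 3 * (a₀ 0 * a₀ 1 * a₀ 2) with hx3
  -- (A,B,C) = (-8, 7, 15), κ = 56
  have κ0 : (56 : K) ≠ 0 := by norm_num
  have R1 : -((-8 : K)) * x0 - (15 : K) * x2 + (7 : K) * x3 = 0 := by
    have : (56 : K) * (-((-8 : K)) * x0 - (15 : K) * x2 + (7 : K) * x3) = 0 := by
      rw [hx0, hx2, hx3]; linear_combination Z1
    exact (mul_eq_zero.1 this).resolve_left κ0
  have R2 : (7 : K) * x0 - (15 : K) * x1 - (-8 : K) * x3 = 0 := by
    have : (56 : K) * ((7 : K) * x0 - (15 : K) * x1 - (-8 : K) * x3) = 0 := by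
      rw [hx0, hx1, hx3]; linear_combination Z2
    exact (mul_eq_zero.1 this).resolve_left κ0
  have R3 : -((15 : K)) * x0 + (7 : K) * x1 - (-8 : K) * x2 = 0 := by
    have : (56 : K) * (-((15 : K)) * x0 + (7 : K) * x1 - (-8 : K) * x2) = 0 := by
      rw [hx0, hx1, hx2]; linear_combination Z3
    exact (mul_eq_zero.1 this).resolve_left κ0
  have S1 : (7 : K) * (x3 - x0) - (15 : K) * (x2 - x0) = 0 := by linear_combination R1
  have S2 : (15 : K) * (x1 - x0) + (-8 : K) * (x3 - x0) = 0 := by linear_combination -R2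
  have S3 : (7 : K) * (x1 - x0) - (-8 : K) * (x2 - x0) = 0 := by linear_combination R3
  have hA : (-8 : K) ≠ 0 := by norm_num
  have hB : (7 : K) ≠ 0 := by norm_num
  have hC : (15 : K) ≠ 0 := by norm_num
  have T2 : 2 * (-8 : K) * (15 : K) * (x2 - x0) = 0 := by
    linear_combination (-((-8 : K))) * S1 + (7 : K) * S2 + (-((15 : K))) * S3
  have d2 : x2 - x0 = 0 :=
    (mul_eq_zero.1 T2).resolve_left (mul_ne_zero (mul_ne_zero two_ne_zero hA) hC)
  have d1 : x1 - x0 = 0 := by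
    have : (7 : K) * (x1 - x0) = 0 := by linear_combination S3 + (-8 : K) * d2
    exact (mul_eq_zero.1 this).resolve_left hB
  have d3 : x3 - x0 = 0 := by
    have : (7 : K) * (x3 - x0) = 0 := by linear_combination S1 + (15 : K) * d2
    exact (mul_eq_zero.1 this).resolve_left hB
  rw [hx0, hx1] at d1; rw [hx0, hx2] at d2; rw [hx0, hx3] at d3
  have p1 : a₁ 1 * a₀ 0 = a₁ 0 * a₀ 1 := by
    have : a₀ 2 * a₀ 3 * (a₁ 1 * a₀ 0 - a₁ 0 * a₀ 1) = 0 := by linear_combination d1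
    have := (mul_eq_zero.1 this).resolve_left (mul_ne_zero ha2 ha3)
    linear_combination this
  have p2 : a₁ 2 * a₀ 0 = a₁ 0 * a₀ 2 := by
    have : a₀ 1 * a₀ 3 * (a₁ 2 * a₀ 0 - a₁ 0 * a₀ 2) = 0 := by linear_combination d2
    have := (mul_eq_zero.1 this).resolve_left (mul_ne_zero ha1 ha3)
    linear_combination this
  have p3 : a₁ 3 * a₀ 0 = a₁ 0 * a₀ 3 := by
    have : a₀ 1 * a₀ 2 * (a₁ 3 * a₀ 0 - a₁ 0 * a₀ 3) = 0 := by linear_combination d3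
    have := (mul_eq_zero.1 this).resolve_left (mul_ne_zero ha1 ha2)
    linear_combination this
  exact hind (a₁ 0 / a₀ 0) (smul_of_ratios a₀ a₁ ha0 p1 p2 p3)

/-- ★ **The `W₀` chart**: frames for `a₁ ∉ K a₀`. [folklore] -/
theorem frames_of_W0_of_indep [CharZero K] (Ψ : Matrix (Fin 4) (Fin 4) K) (a₀ a₁ : Fin 4 → K)
    (ha : ∀ k, a₀ k ≠ 0) (hind : ∀ μ : K, a₁ ≠ μ • a₀)
    (hψ₀₀ : a₀ ⬝ᵥ Ψ *ᵥ (fun k => a₀ k * (![-3, -1, 4, -2] : Fin 4 → K) k) = 0)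
    (hψ₀₁ : a₀ ⬝ᵥ Ψ *ᵥ (fun k => a₀ k * (![-2, -3, 5, 0] : Fin 4 → K) k) = 0)
    (hψ₁₀ : a₁ ⬝ᵥ Ψ *ᵥ (fun k => a₀ k * (![-3, -1, 4, -2] : Fin 4 → K) k) = 0)
    (hψ₁₁ : a₁ ⬝ᵥ Ψ *ᵥ (fun k => a₀ k * (![-2, -3, 5, 0] : Fin 4 → K) k) = 0) :
    ∃ (a₀ a₁ y₀ y₁ : Fin 4 → K) (P₀₀ P₁₀ P₀₁ P₁₁ W₀ : Matrix (Fin 4) (Fin 4) K)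
        (v : Fin 4 → Fin 4 → K) (s : Fin 4 → K) (W : Matrix (Fin 4) (Fin 4) K),
        a₀ ⬝ᵥ Ψ *ᵥ y₀ = 0 ∧ a₀ ⬝ᵥ Ψ *ᵥ y₁ = 0 ∧ a₁ ⬝ᵥ Ψ *ᵥ y₀ = 0 ∧ a₁ ⬝ᵥ Ψ *ᵥ y₁ = 0 ∧
        (∀ b l, P₀₀ b l = (Matrix.of ![a₀, Pi.single b 1, y₀, Pi.single l 1]).permanent) ∧
        (∀ b l, P₁₀ b l = (Matrix.of ![a₀, Pi.single b 1, y₁, Pi.single l 1]).permanent) ∧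
        (∀ b l, P₀₁ b l = (Matrix.of ![a₁, Pi.single b 1, y₀, Pi.single l 1]).permanent) ∧
        (∀ b l, P₁₁ b l = (Matrix.of ![a₁, Pi.single b 1, y₁, Pi.single l 1]).permanent) ∧
        W₀ * P₀₀ = 1 ∧ (∀ j, P₁₀ *ᵥ v j = s j • P₀₀ *ᵥ v j) ∧ (∀ i j, i ≠ j → s i ≠ s j) ∧
        W * Matrix.of v = 1 ∧ P₁₁ - P₁₀ * W₀ * P₀₁ ≠ 0 :=
  frames_of_W0 Ψ a₀ a₁ ha hψ₀₀ hψ₀₁ hψ₁₀ hψ₁₁ (w0_Q_ne_zero a₀ a₁ ha hind)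

end Summit.ValiantsHypothesis.ValiantsHypothesis.Theorems.SymPencilPerFourPeeledTwoPencilChordW0Q

end
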